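import Summits.ResolutionOfSingularities.ResolutionOfSingularities.Theorems.FrobeniusLadderFRationalResolutionSingBlowupRoundRoof
import Summits.ResolutionOfSingularities.ResolutionOfSingularities.Theorems.FrobeniusLadderFRationalResolutionSingBlowupRoundSing
import Summits.ResolutionOfSingularities.ResolutionOfSingularities.Theorems.FrobeniusLadderFRationalResolutionSingBlowupLowMeasure
import HarnessLib

/-!
# Crux `FrobeniusLadder.FRationalResolution` (stmt-ResolutionOfSingularities-15317), line `redirect`,
# stub `stub_diagonalizableQuotientResolution` — **RANK-2 STRATA ARE RESOLVED BY ITERATING THE INTRINSIC BLOW-UP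
# `X ↦ Bl_{𝓘_{Sing X}} X`, over every field, in every dimension, isolated or not** (design C3 = the rank-2 stratum
# layer of the non-isolated case: the global round L3-b and the induction L4, assembled)

THE INVARIANT `𝒞(D)` of an integral `X` locally of finite type over a field `k` (memo MEMO-15317-leafhand2-g10 §2, with
the two bookkeeping clauses that make the pointwise singular-locus description propagate): at every SINGULAR point `x`
there are a base chart `(A, P, φ, 𝔭)` (fs, saturated, spanning; Kato-log-regular at `𝔭`, below `𝔭` along the stratum,
and — bookkeeping — at every prime below any base point under the roof; rank bound `n − rk F_𝔭 ≤ 2`), a cone chart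
algebra `(C, Q, χ)` over it in normal form `ℤF_𝔭 + {m u + l e : l ≥ 0, a l ≤ d m}` with `a < d ≤ D`, a prime `𝔓` over
`𝔭` containing `χ(Q ∖ ℤF_𝔭)`, an étale roof `X ←ρ— Y —j↪ Spec C` through `x` with `j y = 𝔓`, the pointwise description
«`¬ regular C_{j y'} ↔ I(𝔓, χ) ⊆ j y'`» of the singular locus on the roof, and — bookkeeping — the unit face `F_𝔭`
staying units under the roof. (Written out as an `∃`-package: proof files carry no definitions.)

* **`invariant_of_isBlowup`** (L3-b, global): if `X ∈ 𝒞(D)` and `π : X₁ → X` is ANY blowing up along `𝓘_{Sing X}`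
  then `X₁ ∈ 𝒞(D − 2)` — at a singular `x₁` over `x`: `…SingBlowupRoundRoof.exists_chart_of_singular_point'` (the chart
  `h`, `2 ≤ c ≤ d − 2`, the new fixed prime and roof), `…FixedStratumNextRound.exists_fixedPrime_package_of_stratum`
  (the chart algebra `C_h` is again a cone chart algebra, measure `c`), `…SingBlowupRoundSing` (the description
  propagates); over `Reg X` the blow-up is regular (`…SingBlowupLowMeasure`).
* **`hasResolution_of_invariant`** (L4): `X ∈ 𝒞(D) ⇒ Scheme.HasResolution X`, by induction on `D` along
  `singBlowup X f = Bl_{𝓘_{Sing X}} X → X` (proper birational, tree `LipmanProcedure`; `Scheme.HasResolution.of_isBirational`).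

What remains for `stub_diagonalizableQuotientResolution` on the rank-≤-2 locus is the ENTRY `hq ⇒ 𝒞(D)` (round 0: a
sharp rank-2 chart log regular on a neighbourhood, `…FixedStratumEntry`, and the description of the singular locus of
the base chart near the point). Honest label: assembly toward ONE leaf stub (no stub, crux or summit closed). No
definitions, no named facts, no sorry. [cite: Kato1994, (7.3), (10.1), (10.3)] [cite: Liu2002, §8.3.4, (3.11)]
[cite: GortzWedhorn2020, Prop. 13.91] [cite: KempfEtAl1973, Ch. I §2]
-/

noncomputable section

-- single-problem summit: the doubled namespace component is forced
set_option linter.dupNamespace false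

open CategoryTheory CategoryTheory.Limits AlgebraicGeometry TopologicalSpace
open IsLocalRing Literature.AlgebraicGeometry.Resolution Literature.AlgebraicGeometry.Resolution.LogChart
open Summit.ResolutionOfSingularities.ResolutionOfSingularities.Theorems.FRationalResolution

namespace Summit.ResolutionOfSingularities.ResolutionOfSingularities.Theorems.FRationalResolution.SingBlowupInduction

set_option maxHeartbeats 1600000 in
/-- **The global round: `X ∈ 𝒞(D)` and `π : X₁ → X` a blowing up along `𝓘_{Sing X}` give `X₁ ∈ 𝒞(D − 2)`.** See the
module docstring. [cite: Kato1994, (7.3), (10.1), (10.3)] [cite: GortzWedhorn2020, Prop. 13.91] -/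
theorem invariant_of_isBlowup (D : ℕ) {k : Type} [Field k] {X X₁ : Scheme.{0}} (f : X ⟶ Spec (.of k))
    [LocallyOfFiniteType f] {π : X₁ ⟶ X} (hπ : IsBlowup π (singularLocusIdeal X f))
    (H : ∀ x : X, x ∉ Scheme.regularLocus X →
      ∃ (A : Type) (_ : CommRing A) (_ : IsNoetherianRing A) (n : ℕ) (P : AddSubmonoid (Fin n → ℤ))
          (φ : Multiplicative P →* A) (𝔭 : Ideal A) (_ : 𝔭.IsPrime) (C : Type) (_ : CommRing C) (_ : Algebra A C)
          (_ : IsNoetherianRing C) (Q : AddSubmonoid (Fin n → ℤ)) (χ : Multiplicative Q →* C) (u e : Fin n → ℤ)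
          (a d : ℕ), a < d ∧ d ≤ D ∧ P.FG ∧
          (∀ (w : Fin n → ℤ) (k : ℕ), 0 < k → k • w ∈ P → w ∈ P) ∧
          Submodule.span ℤ (P : Set (Fin n → ℤ)) = ⊤ ∧ IsLogRegularAt P φ 𝔭 ∧
          ∃ (hPQ : P ≤ Q),
          (∀ p : P, χ (Multiplicative.ofAdd ⟨(p : Fin n → ℤ), hPQ p.2⟩) =
            algebraMap A C (φ (Multiplicative.ofAdd p))) ∧
          Algebra.adjoin A (Set.range χ) = ⊤ ∧
          (∀ q ∈ Q, ∃ p ∈ P, q + p ∈ P) ∧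
          (∀ a : A, algebraMap A C a = 0 → ∃ p : P, φ (Multiplicative.ofAdd p) * a = 0) ∧
          (∀ (K : Type) [Field K] (g : A →+* K), (∀ p : P, g (φ (Multiplicative.ofAdd p)) ≠ 0) →
            ∃ ω : C →+* K, ω.comp (algebraMap A C) = g) ∧
          Q.FG ∧
          (∀ w, w ∈ Q ↔ ∃ g ∈ Submodule.span ℤ (faceMonoid P φ 𝔭 : Set (Fin n → ℤ)), ∃ m l : ℤ,
            0 ≤ l ∧ (a : ℤ) * l ≤ (d : ℤ) * m ∧ w = g + m • u + l • e) ∧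
          (∀ g ∈ Submodule.span ℤ (faceMonoid P φ 𝔭 : Set (Fin n → ℤ)), ∀ m l : ℤ,
            g + m • u + l • e = 0 → m = 0 ∧ l = 0) ∧
          (∀ w : Fin n → ℤ, ∃ g ∈ Submodule.span ℤ (faceMonoid P φ 𝔭 : Set (Fin n → ℤ)),
            ∃ m l : ℤ, w = g + m • u + l • e) ∧
          (∀ (𝔮 : Ideal A) [𝔮.IsPrime], 𝔮 ≤ 𝔭 → ideal P φ 𝔭 ≤ 𝔮 → IsLogRegularAt P φ 𝔮) ∧
          n - Module.finrank ℤ (Submodule.span ℤ (faceMonoid P φ 𝔭 : Set (Fin n → ℤ))) ≤ 2 ∧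
          ∃ (𝔓 : Ideal C) (_ : 𝔓.IsPrime), 𝔓.comap (algebraMap A C) = 𝔭 ∧
            (∀ q : Q, (q : Fin n → ℤ) ∉ Submodule.span ℤ (faceMonoid P φ 𝔭 : Set (Fin n → ℤ)) →
              χ (Multiplicative.ofAdd q) ∈ 𝔓) ∧
            ∃ (Y : Scheme.{0}) (ρ : Y ⟶ X) (_ : Etale ρ) (j : Y ⟶ Spec (.of C)) (_ : IsOpenImmersion j) (y : Y),
              ρ y = x ∧ (j y).asIdeal = 𝔓 ∧
              (∀ y' : Y, ¬ IsRegularLocalRing (Localization.AtPrime (j y').asIdeal) ↔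
                ideal Q χ 𝔓 ≤ (j y').asIdeal) ∧
              (∀ y' : Y, ∀ w ∈ faceMonoid P φ 𝔭, val P φ w ∉ ((j y').asIdeal).comap (algebraMap A C)) ∧
              (∀ (y' : Y) (𝔮 : Ideal A) [𝔮.IsPrime], 𝔮 ≤ ((j y').asIdeal).comap (algebraMap A C) →
                IsLogRegularAt P φ 𝔮)) :
    ∀ x₁ : X₁, x₁ ∉ Scheme.regularLocus X₁ →
      ∃ (A : Type) (_ : CommRing A) (_ : IsNoetherianRing A) (n : ℕ) (P : AddSubmonoid (Fin n → ℤ))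
          (φ : Multiplicative P →* A) (𝔭 : Ideal A) (_ : 𝔭.IsPrime) (C : Type) (_ : CommRing C) (_ : Algebra A C)
          (_ : IsNoetherianRing C) (Q : AddSubmonoid (Fin n → ℤ)) (χ : Multiplicative Q →* C) (u e : Fin n → ℤ)
          (a d : ℕ), a < d ∧ d ≤ D - 2 ∧ P.FG ∧
          (∀ (w : Fin n → ℤ) (k : ℕ), 0 < k → k • w ∈ P → w ∈ P) ∧
          Submodule.span ℤ (P : Set (Fin n → ℤ)) = ⊤ ∧ IsLogRegularAt P φ 𝔭 ∧
          ∃ (hPQ : P ≤ Q),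
          (∀ p : P, χ (Multiplicative.ofAdd ⟨(p : Fin n → ℤ), hPQ p.2⟩) =
            algebraMap A C (φ (Multiplicative.ofAdd p))) ∧
          Algebra.adjoin A (Set.range χ) = ⊤ ∧
          (∀ q ∈ Q, ∃ p ∈ P, q + p ∈ P) ∧
          (∀ a : A, algebraMap A C a = 0 → ∃ p : P, φ (Multiplicative.ofAdd p) * a = 0) ∧
          (∀ (K : Type) [Field K] (g : A →+* K), (∀ p : P, g (φ (Multiplicative.ofAdd p)) ≠ 0) →
            ∃ ω : C →+* K, ω.comp (algebraMap A C) = g) ∧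
          Q.FG ∧
          (∀ w, w ∈ Q ↔ ∃ g ∈ Submodule.span ℤ (faceMonoid P φ 𝔭 : Set (Fin n → ℤ)), ∃ m l : ℤ,
            0 ≤ l ∧ (a : ℤ) * l ≤ (d : ℤ) * m ∧ w = g + m • u + l • e) ∧
          (∀ g ∈ Submodule.span ℤ (faceMonoid P φ 𝔭 : Set (Fin n → ℤ)), ∀ m l : ℤ,
            g + m • u + l • e = 0 → m = 0 ∧ l = 0) ∧
          (∀ w : Fin n → ℤ, ∃ g ∈ Submodule.span ℤ (faceMonoid P φ 𝔭 : Set (Fin n → ℤ)),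
            ∃ m l : ℤ, w = g + m • u + l • e) ∧
          (∀ (𝔮 : Ideal A) [𝔮.IsPrime], 𝔮 ≤ 𝔭 → ideal P φ 𝔭 ≤ 𝔮 → IsLogRegularAt P φ 𝔮) ∧
          n - Module.finrank ℤ (Submodule.span ℤ (faceMonoid P φ 𝔭 : Set (Fin n → ℤ))) ≤ 2 ∧
          ∃ (𝔓 : Ideal C) (_ : 𝔓.IsPrime), 𝔓.comap (algebraMap A C) = 𝔭 ∧
            (∀ q : Q, (q : Fin n → ℤ) ∉ Submodule.span ℤ (faceMonoid P φ 𝔭 : Set (Fin n → ℤ)) →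
              χ (Multiplicative.ofAdd q) ∈ 𝔓) ∧
            ∃ (Y : Scheme.{0}) (ρ : Y ⟶ X₁) (_ : Etale ρ) (j : Y ⟶ Spec (.of C)) (_ : IsOpenImmersion j) (y : Y),
              ρ y = x₁ ∧ (j y).asIdeal = 𝔓 ∧
              (∀ y' : Y, ¬ IsRegularLocalRing (Localization.AtPrime (j y').asIdeal) ↔
                ideal Q χ 𝔓 ≤ (j y').asIdeal) ∧
              (∀ y' : Y, ∀ w ∈ faceMonoid P φ 𝔭, val P φ w ∉ ((j y').asIdeal).comap (algebraMap A C)) ∧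
              (∀ (y' : Y) (𝔮 : Ideal A) [𝔮.IsPrime], 𝔮 ≤ ((j y').asIdeal).comap (algebraMap A C) →
                IsLogRegularAt P φ 𝔮) := by
  intro x₁ hx₁
  classical
  by_cases hx : π x₁ ∈ Scheme.regularLocus X
  · exact absurd (SingBlowupLowMeasure.mem_regularLocus_of_isBlowup_singularLocusIdeal f hπ x₁ hx) hx₁
  obtain ⟨A, _, _, n, P, φ, 𝔭, _, C, _, _, _, Q, χ, u, e, a, d, had, hdD, hP, hsat, hspanP, hreg, hPQ, hχ, hgen,
    hD, hK, hΩ, hQfg, hQ, hind, hspan, hreg', hrank, 𝔓, _, h𝔓A, h𝔓q, Y, ρ, _, j, _, y, hρy, hjy, hSing, hFunit,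
    hregY⟩ := H _ hx
  obtain ⟨s, hsfin, hsQ, hsL, hsgen, h, hhQ, hhs, v, x, c, hc2, hcd, hQh, hindvx, hspanvx, 𝔔, h𝔔, h𝔔A, h𝔔q, hsing,
      Y', ρ', _, j', _, y', hρ'y, hj'y, hbook⟩ :=
    SingBlowupRoundRoof.exists_chart_of_singular_point' f hπ had hP hsat hspanP hreg hPQ hχ hgen hD hK hΩ hQfg hQ
      hind hspan hreg' hrank 𝔓 h𝔓A h𝔓q ρ j y hjy hSing x₁ hρy.symm hx₁
  haveI := h𝔔
  obtain ⟨𝔓h, _, -, -, -, -, -, hχ₂, hgen₂, hD₂, hK₂, hΩ₂, hfg₂, hcone, hind', hspan'⟩ :=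
    FixedStratumNextRound.exists_fixedPrime_package_of_stratum hc2 hsfin hP hsat hspanP hreg hreg' hrank hPQ hχ hgen
      hD hK hΩ hQfg hhQ hQh hindvx hspanvx
  haveI : IsNoetherianRing (blowupAlgebra (Ideal.span ((fun q : Q => χ (Multiplicative.ofAdd q)) '' {q : Q | (q : Fin n → ℤ) ∈ s})) (χ (Multiplicative.ofAdd ⟨h, hhQ⟩))) := isNoetherianRing_blowupAlgebra_of_isNoetherianRing _ _
  -- the contraction of a point of the new roof to `A` is that of a point of the old roof
  have hcomapA : ∀ (y₃ : Y') (y₀ : Y), ((j' y₃).asIdeal).comap (algebraMap C (blowupAlgebra (Ideal.span ((fun q : Q => χ (Multiplicative.ofAdd q)) '' {q : Q | (q : Fin n → ℤ) ∈ s})) (χ (Multiplicative.ofAdd ⟨h, hhQ⟩)))) = (j y₀).asIdeal →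
      ((j' y₃).asIdeal).comap (algebraMap A (blowupAlgebra (Ideal.span ((fun q : Q => χ (Multiplicative.ofAdd q)) '' {q : Q | (q : Fin n → ℤ) ∈ s})) (χ (Multiplicative.ofAdd ⟨h, hhQ⟩)))) = ((j y₀).asIdeal).comap (algebraMap A C) := by
    intro y₃ y₀ hb1
    rw [IsScalarTower.algebraMap_eq A C (blowupAlgebra (Ideal.span ((fun q : Q => χ (Multiplicative.ofAdd q)) '' {q : Q | (q : Fin n → ℤ) ∈ s})) (χ (Multiplicative.ofAdd ⟨h, hhQ⟩))), ← Ideal.comap_comap, hb1]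
  refine ⟨A, inferInstance, inferInstance, n, P, φ, 𝔭, inferInstance, _, inferInstance, inferInstance, inferInstance,
    blowupChartMonoid Q {q : Q | (q : Fin n → ℤ) ∈ s} ⟨h, hhQ⟩,
    blowupChart Q χ {q : Q | (q : Fin n → ℤ) ∈ s} ⟨h, hhQ⟩, x, v - x, c - 1, c, by omega, by omega, hP, hsat,
    hspanP, hreg, hPQ.trans (le_blowupChartMonoid Q _ ⟨h, hhQ⟩), hχ₂, hgen₂, hD₂, hK₂, hΩ₂, hfg₂, hcone, hind',
    hspan', hreg', hrank, 𝔔, h𝔔, h𝔔A, h𝔔q, Y', ρ', inferInstance, j', inferInstance, y', hρ'y, hj'y, fun y₃ => ?_,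
    fun y₃ w hw => ?_, fun y₃ 𝔮 _ h𝔮 => ?_⟩
  · -- the description propagates
    obtain ⟨y₀, hb1, -, hb3⟩ := hbook y₃
    have hSing₀ : ¬ IsRegularLocalRing (Localization.AtPrime (((j' y₃).asIdeal).comap (algebraMap C (blowupAlgebra (Ideal.span ((fun q : Q => χ (Multiplicative.ofAdd q)) '' {q : Q | (q : Fin n → ℤ) ∈ s})) (χ (Multiplicative.ofAdd ⟨h, hhQ⟩)))))) ↔
        ideal Q χ 𝔓 ≤ ((j' y₃).asIdeal).comap (algebraMap C (blowupAlgebra (Ideal.span ((fun q : Q => χ (Multiplicative.ofAdd q)) '' {q : Q | (q : Fin n → ℤ) ∈ s})) (χ (Multiplicative.ofAdd ⟨h, hhQ⟩)))) := by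
      have gen : ∀ (I : Ideal C) [I.IsPrime], I = (j y₀).asIdeal →
          (¬ IsRegularLocalRing (Localization.AtPrime I) ↔ ideal Q χ 𝔓 ≤ I) := by
        rintro I _ rfl; exact hSing y₀
      exact gen _ hb1
    have hoff : ¬ Ideal.span ((fun q : Q => χ (Multiplicative.ofAdd q)) '' {q : Q | (q : Fin n → ℤ) ∈ s}) ≤
          ((j' y₃).asIdeal).comap (algebraMap C (blowupAlgebra (Ideal.span ((fun q : Q => χ (Multiplicative.ofAdd q)) '' {q : Q | (q : Fin n → ℤ) ∈ s})) (χ (Multiplicative.ofAdd ⟨h, hhQ⟩)))) →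
        (IsRegularLocalRing (Localization.AtPrime (j' y₃).asIdeal) ↔
          IsRegularLocalRing (Localization.AtPrime (((j' y₃).asIdeal).comap (algebraMap C (blowupAlgebra (Ideal.span ((fun q : Q => χ (Multiplicative.ofAdd q)) '' {q : Q | (q : Fin n → ℤ) ∈ s})) (χ (Multiplicative.ofAdd ⟨h, hhQ⟩))))))) := by
      have gen : ∀ (I : Ideal C) [I.IsPrime], I = (j y₀).asIdeal →
          (¬ Ideal.span ((fun q : Q => χ (Multiplicative.ofAdd q)) '' {q : Q | (q : Fin n → ℤ) ∈ s}) ≤ I →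
            (IsRegularLocalRing (Localization.AtPrime (j' y₃).asIdeal) ↔
              IsRegularLocalRing (Localization.AtPrime I))) := by
        rintro I _ rfl; exact hb3
      exact gen _ hb1
    have hFunit₃ : ∀ w ∈ faceMonoid P φ 𝔭, val P φ w ∉ ((j' y₃).asIdeal).comap (algebraMap A (blowupAlgebra (Ideal.span ((fun q : Q => χ (Multiplicative.ofAdd q)) '' {q : Q | (q : Fin n → ℤ) ∈ s})) (χ (Multiplicative.ofAdd ⟨h, hhQ⟩)))) := by
      intro w hw; rw [hcomapA y₃ y₀ hb1]; exact hFunit y₀ w hw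
    have hregY₃ : ∀ (𝔮 : Ideal A) [𝔮.IsPrime], 𝔮 ≤ ((j' y₃).asIdeal).comap (algebraMap A (blowupAlgebra (Ideal.span ((fun q : Q => χ (Multiplicative.ofAdd q)) '' {q : Q | (q : Fin n → ℤ) ∈ s})) (χ (Multiplicative.ofAdd ⟨h, hhQ⟩)))) →
        IsLogRegularAt P φ 𝔮 := by
      intro 𝔮 _ h𝔮; rw [hcomapA y₃ y₀ hb1] at h𝔮; exact hregY y₀ 𝔮 h𝔮
    have key := SingBlowupRoundSing.singular_iff_forall_mem_of_chart hc2 hsfin hP hsat hspanP hrank hPQ hχ hgen hD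
      hK hΩ hQfg hhQ hQh hindvx hspanvx hsQ hsL hsgen 𝔓 h𝔓A h𝔓q (j' y₃).asIdeal hSing₀ hoff hFunit₃ hregY₃
    exact key.trans (SingBlowupRoundSing.forall_mem_iff_ideal_le hPQ hχ hhQ 𝔔 h𝔔A h𝔔q _)
  · obtain ⟨y₀, hb1, -, -⟩ := hbook y₃
    rw [hcomapA y₃ y₀ hb1]; exact hFunit y₀ w hw
  · obtain ⟨y₀, hb1, -, -⟩ := hbook y₃
    rw [hcomapA y₃ y₀ hb1] at h𝔮; exact hregY y₀ 𝔮 h𝔮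

set_option maxHeartbeats 800000 in
/-- **Rank-2 strata are resolved by iterating the intrinsic blow-up**: `X ∈ 𝒞(D) ⇒ Scheme.HasResolution X`, for an
integral `X` locally of finite type over any field, by induction on `D` along `Bl_{𝓘_{Sing X}} X → X`. See the module
docstring. [cite: Kato1994, (10.1), (10.3)] [cite: Liu2002, §8.3.4, (3.11)] [cite: KempfEtAl1973, Ch. I §2] -/
theorem hasResolution_of_invariant (D : ℕ) :
    ∀ {k : Type} [Field k] (X : Scheme.{0}) [IsIntegral X] (f : X ⟶ Spec (.of k)) [LocallyOfFiniteType f],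
    (∀ x : X, x ∉ Scheme.regularLocus X →
      ∃ (A : Type) (_ : CommRing A) (_ : IsNoetherianRing A) (n : ℕ) (P : AddSubmonoid (Fin n → ℤ))
          (φ : Multiplicative P →* A) (𝔭 : Ideal A) (_ : 𝔭.IsPrime) (C : Type) (_ : CommRing C) (_ : Algebra A C)
          (_ : IsNoetherianRing C) (Q : AddSubmonoid (Fin n → ℤ)) (χ : Multiplicative Q →* C) (u e : Fin n → ℤ)
          (a d : ℕ), a < d ∧ d ≤ D ∧ P.FG ∧
          (∀ (w : Fin n → ℤ) (k : ℕ), 0 < k → k • w ∈ P → w ∈ P) ∧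
          Submodule.span ℤ (P : Set (Fin n → ℤ)) = ⊤ ∧ IsLogRegularAt P φ 𝔭 ∧
          ∃ (hPQ : P ≤ Q),
          (∀ p : P, χ (Multiplicative.ofAdd ⟨(p : Fin n → ℤ), hPQ p.2⟩) =
            algebraMap A C (φ (Multiplicative.ofAdd p))) ∧
          Algebra.adjoin A (Set.range χ) = ⊤ ∧
          (∀ q ∈ Q, ∃ p ∈ P, q + p ∈ P) ∧
          (∀ a : A, algebraMap A C a = 0 → ∃ p : P, φ (Multiplicative.ofAdd p) * a = 0) ∧
          (∀ (K : Type) [Field K] (g : A →+* K), (∀ p : P, g (φ (Multiplicative.ofAdd p)) ≠ 0) →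
            ∃ ω : C →+* K, ω.comp (algebraMap A C) = g) ∧
          Q.FG ∧
          (∀ w, w ∈ Q ↔ ∃ g ∈ Submodule.span ℤ (faceMonoid P φ 𝔭 : Set (Fin n → ℤ)), ∃ m l : ℤ,
            0 ≤ l ∧ (a : ℤ) * l ≤ (d : ℤ) * m ∧ w = g + m • u + l • e) ∧
          (∀ g ∈ Submodule.span ℤ (faceMonoid P φ 𝔭 : Set (Fin n → ℤ)), ∀ m l : ℤ,
            g + m • u + l • e = 0 → m = 0 ∧ l = 0) ∧
          (∀ w : Fin n → ℤ, ∃ g ∈ Submodule.span ℤ (faceMonoid P φ 𝔭 : Set (Fin n → ℤ)),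
            ∃ m l : ℤ, w = g + m • u + l • e) ∧
          (∀ (𝔮 : Ideal A) [𝔮.IsPrime], 𝔮 ≤ 𝔭 → ideal P φ 𝔭 ≤ 𝔮 → IsLogRegularAt P φ 𝔮) ∧
          n - Module.finrank ℤ (Submodule.span ℤ (faceMonoid P φ 𝔭 : Set (Fin n → ℤ))) ≤ 2 ∧
          ∃ (𝔓 : Ideal C) (_ : 𝔓.IsPrime), 𝔓.comap (algebraMap A C) = 𝔭 ∧
            (∀ q : Q, (q : Fin n → ℤ) ∉ Submodule.span ℤ (faceMonoid P φ 𝔭 : Set (Fin n → ℤ)) →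
              χ (Multiplicative.ofAdd q) ∈ 𝔓) ∧
            ∃ (Y : Scheme.{0}) (ρ : Y ⟶ X) (_ : Etale ρ) (j : Y ⟶ Spec (.of C)) (_ : IsOpenImmersion j) (y : Y),
              ρ y = x ∧ (j y).asIdeal = 𝔓 ∧
              (∀ y' : Y, ¬ IsRegularLocalRing (Localization.AtPrime (j y').asIdeal) ↔
                ideal Q χ 𝔓 ≤ (j y').asIdeal) ∧
              (∀ y' : Y, ∀ w ∈ faceMonoid P φ 𝔭, val P φ w ∉ ((j y').asIdeal).comap (algebraMap A C)) ∧
              (∀ (y' : Y) (𝔮 : Ideal A) [𝔮.IsPrime], 𝔮 ≤ ((j y').asIdeal).comap (algebraMap A C) →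
                IsLogRegularAt P φ 𝔮)) →
    Scheme.HasResolution X := by
  induction D using Nat.strong_induction_on with
  | _ D ih =>
  intro k _ X _ f _ H
  have H₁ := invariant_of_isBlowup D f (blowup.isBlowup (singularLocusIdeal X f)) H
  rcases Nat.eq_zero_or_pos D with hD | hD
  · -- `D = 0`: no singular point can carry the invariant, `X` is regular, hence so is the blow-up
    have hreg₁ : Scheme.IsRegular (singBlowup X f) := by
      intro x₁
      by_contra hx₁
      obtain ⟨A, _, _, n, P, φ, 𝔭, _, C, _, _, _, Q, χ, u, e, a, d, had, hdD, -⟩ := H₁ x₁ hx₁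
      omega
    exact ⟨_, singBlowup.π X f, ⟨inferInstance, singBlowup.isBirational X f, hreg₁⟩⟩
  · have h₁ : Scheme.HasResolution (singBlowup X f) :=
      ih (D - 2) (by omega) (singBlowup X f) (singBlowup.π X f ≫ f) H₁
    exact Scheme.HasResolution.of_isBirational (singBlowup.π X f) (singBlowup.isBirational X f) h₁

end Summit.ResolutionOfSingularities.ResolutionOfSingularities.Theorems.FRationalResolution.SingBlowupInduction

end
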